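import Summits.HubbardSuperconductivity.HubbardSuperconductivity.Theorems.MesoscopicPairOrder.Negative.StonerExactDoublon
import Mathlib.Analysis.Real.Pi.Bounds
import HarnessLib

/-!
# Crux `MesoscopicPairOrder` (stmt-HubbardSuperconductivity-7331), Negative side:
# NO NEARLY SATURATED FERROMAGNETISM FOR `U ≤ 7/2` ON `δ ∈ [1/10, 3/10]`

Line `redirect_birth` (lead c10); companion of `StonerExactDoublon.lean`. With the exact doublon density of
the paired Fermi sea (`U n²/L²` instead of `U n`) the Stoner exclusion of nearly saturated sector ground
states — the hypothesis of the refuter instruments `pointwise_false_of_nearlySaturated` (crux body) and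
`fluctuationFloorAt_false_of_nearlySaturated` (stub (Q)) — extends from `U ≤ 6/5`
(`StonerModerateCoupling.lean`) to `U ≤ 7/2`:

* `spinDeficiency_ge_of_coupling_le` — **for `0 ≤ U ≤ 7/2`, `δ ∈ [1/10, 3/10]` and every `L ≥ 6000`, every
  ground state `ψ` of the `(2n, S^z = 0)` sector (`n = ⌊(1-δ)L²/2⌋`) of `hubbardTorus 2 L 1 U` with
  `S² ψ = S(S+1) ψ`, `S ≤ n`, has `n - S ≥ L²/200`.** Four pieces, all with the centred-square paired sea
  `exists_trialSet_card_eq` (largest odd square `m × m`, `m² ≤ n < (m+2)²`, `a L - 3 < m < b L`,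
  `sin(mπ/L) ≥ 1 - (π(b - 1/2))²/2`): `δ ∈ [1/10, 3/20]` and `[3/20, 1/5]` by the band-edge bound
  `eight_spin_le_of_pairedSea_exact` (`(a, b, sin) = (0.6519, 0.6709, 0.855)`, `(0.6324, 0.652, 0.885)`);
  `δ ∈ [1/5, 1/4]` and `[1/4, 3/10]` by the shifted bound `shifted_spin_le_of_pairedSea_exact` at
  `(μ, t) = (7/5, 39/10)`, `(13/10, 37/10)` (`(a, b, sin) = (0.6123, 0.6325, 0.913)`, `(0.5916, 0.6124, 0.937)`).
  The quadratic term `-U n²/L²` is handled by monotonicity of `n ↦ c n - (U/L²) n²` on each piece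
  (`c ≥ (U/L²)(n + n₀)`), so the smallest filling of the piece is the worst case.
* `not_nearlySaturated_frequently_of_coupling_le` — the near-saturation refuter hypothesis fails at every
  `(U, δ) ∈ [0, 7/2] × [1/10, 3/10]` (supersedes `…_of_moderateCoupling`, `U ≤ 6/5`).

Reach: the exact continuum Stoner gap allows `U ≈ 6.3`; still lost are the square trial sea (`≈ 0.11`/site)
and the degree-2 moment bound of the polarised bathtub (`≈ 0.2`/site for `δ ≥ 0.2`) — inputs for `U ≤ 6`.
Sources: E. C. Stoner, Proc. R. Soc. A 165 (1938) 372; D. R. Penn, Phys. Rev. 142 (1966) 350, §II;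
H. Tasaki, Prog. Theor. Phys. 99 (1998) 489, §5. Folklore finite-dimensional statements; no definition,
no named fact, no sorry.
-/

noncomputable section

-- the summit namespace repeats the problem name by design (D-0017)
set_option linter.dupNamespace false

namespace Summit.HubbardSuperconductivity.HubbardSuperconductivity.Theorems.MesoscopicPairOrder.Negative

open Matrix Finset Filter
open Literature.Probability.LatticeModels Literature.MathematicalPhysics.QuantumLattice
open scoped ComplexOrder ComplexConjugate

section Box

variable {L : ℕ} [NeZero L]

/-! ### Elementary inputs: the sine at the square's side ratio, the side bounds, the pieces' arithmetic -/

omit [NeZero L] in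
/-- **`sin(π s) ≥ 1 - (3.141593 τ)²/2` for `1/2 ≤ s ≤ 1/2 + τ`, `0 ≤ τ ≤ 1/2`** (`sin(πs) = cos(π(s - 1/2))`,
`cos` decreasing on `[0, π]`, `cos y ≥ 1 - y²/2`, `π < 3.141593`). [folklore] -/
theorem sin_pi_mul_ge_of_le {s τ : ℝ} (hs1 : 1 / 2 ≤ s) (hs2 : s ≤ 1 / 2 + τ) (hτ0 : 0 ≤ τ) (hτ1 : τ ≤ 1 / 2) :
    1 - (3.141593 * τ) ^ 2 / 2 ≤ Real.sin (Real.pi * s) := by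
  have hπ := Real.pi_pos
  have hπ3 := Real.pi_lt_d6
  rw [← Real.cos_sub_pi_div_two]
  have hx0 : 0 ≤ Real.pi * s - Real.pi / 2 := by nlinarith
  have hxy : Real.pi * s - Real.pi / 2 ≤ Real.pi * τ := by nlinarith
  have hyπ : Real.pi * τ ≤ Real.pi := by nlinarith
  have h1 : Real.cos (Real.pi * τ) ≤ Real.cos (Real.pi * s - Real.pi / 2) :=
    Real.cos_le_cos_of_nonneg_of_le_pi hx0 hyπ hxy
  have h2 : 1 - (Real.pi * τ) ^ 2 / 2 ≤ Real.cos (Real.pi * τ) := Real.one_sub_sq_div_two_le_cos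
  have h3 : (Real.pi * τ) ^ 2 ≤ (3.141593 * τ) ^ 2 :=
    pow_le_pow_left₀ (by positivity) (by nlinarith) 2
  nlinarith

omit [NeZero L] in
/-- Side bounds of the largest centred odd square (pure arithmetic): `m² ≤ n < (m+2)²`, `(aL - 1)² ≤ n`,
`n < (bL)²`, `0 ≤ bL` give `aL - 3 < m < bL`. [folklore] -/
theorem square_side_bounds_of {L m n a b : ℝ} (hm0 : 0 ≤ m) (h1 : m ^ 2 ≤ n) (h2 : n < (m + 2) ^ 2)
    (hlo : (a * L - 1) ^ 2 ≤ n) (hhi : n < (b * L) ^ 2) (hb : 0 ≤ b * L) :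
    a * L - 3 < m ∧ m < b * L := by
  constructor
  · have hlt : (a * L - 1) ^ 2 < (m + 2) ^ 2 := by linarith
    have := lt_of_pow_lt_pow_left₀ 2 (by positivity) hlt
    linarith
  · have hlt : m ^ 2 < (b * L) ^ 2 := by linarith
    exact lt_of_pow_lt_pow_left₀ 2 hb hlt

omit [NeZero L] in
/-- The quadratic bookkeeping shared by the pieces: with `w = U/L² ≥ 0`, `wL² ≤ 7/2`, `0 ≤ n - n₀`,
`n + n₀ ≤ σ L²`, `(7/2) σ ≤ c`: `c n₀ - w n₀² ≤ c n - w n²` (monotonicity of `n ↦ c n - w n²` up to `n`). [folklore] -/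
theorem quad_mono {w L n n₀ σ c : ℝ} (hw0 : 0 ≤ w) (hwL : w * L ^ 2 ≤ 7 / 2) (hn0 : 0 ≤ n - n₀)
    (hsum : n + n₀ ≤ σ * L ^ 2) (hσ : 0 ≤ σ) (hc : 7 / 2 * σ ≤ c) :
    c * n₀ - w * n₀ ^ 2 ≤ c * n - w * n ^ 2 := by
  have hws : w * (n + n₀) ≤ 7 / 2 * σ := by
    calc w * (n + n₀) ≤ w * (σ * L ^ 2) := mul_le_mul_of_nonneg_left hsum hw0
      _ = σ * (w * L ^ 2) := by ring
      _ ≤ σ * (7 / 2) := mul_le_mul_of_nonneg_left hwL hσ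
      _ = 7 / 2 * σ := by ring
  have hkey : 0 ≤ (n - n₀) * (c - w * (n + n₀)) := mul_nonneg hn0 (by linarith)
  nlinarith [hkey]

omit [NeZero L] in
/-- `w n₀² ≤ (7/2) ν² L²` for `n₀ ≤ ν L²`, `0 ≤ n₀`, `w L² ≤ 7/2`, `w ≥ 0`. [folklore] -/
theorem quad_ceiling {w L n₀ ν : ℝ} (hw0 : 0 ≤ w) (hwL : w * L ^ 2 ≤ 7 / 2) (hn0 : 0 ≤ n₀)
    (hn : n₀ ≤ ν * L ^ 2) : w * n₀ ^ 2 ≤ 7 / 2 * ν ^ 2 * L ^ 2 := by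
  have h1 : n₀ ^ 2 ≤ (ν * L ^ 2) ^ 2 := pow_le_pow_left₀ hn0 hn 2
  calc w * n₀ ^ 2 ≤ w * (ν * L ^ 2) ^ 2 := mul_le_mul_of_nonneg_left h1 hw0
    _ = ν ^ 2 * L ^ 2 * (w * L ^ 2) := by ring
    _ ≤ ν ^ 2 * L ^ 2 * (7 / 2) := mul_le_mul_of_nonneg_left hwL (by positivity)
    _ = 7 / 2 * ν ^ 2 * L ^ 2 := by ring

omit [NeZero L] in
/-- Piece `δ ∈ [1/10, 3/20]` (band edge; pure arithmetic). [folklore] -/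
theorem deficiency_exact_arith_A1 {L n S T A B sur U : ℝ} (hL : 6000 ≤ L) (hU0 : 0 ≤ U) (hU1 : U ≤ 7 / 2)
    (hn_lo : 0.425 * L ^ 2 - 1 ≤ n) (hn_hi : n ≤ 0.45 * L ^ 2)
    (hstoner : 8 * S ≤ 4 * L ^ 2 + 2 * T + U * (n ^ 2 / L ^ 2))
    (hT : T ≤ -4 * A * B + 4 * sur) (hM : 0.855 * (0.6519 * L - 3) * (L * (1 / 3.141593)) ≤ A * B)
    (hsur : sur ≤ 4 * L + 3) : L ^ 2 / 200 ≤ n - S := by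
  have hLpos : 0 < L := by linarith
  have hL2 : 0 < L ^ 2 := by positivity
  have hLL : 6000 * L ≤ L ^ 2 := by nlinarith
  set w := U / L ^ 2 with hw
  have hw0 : 0 ≤ w := div_nonneg hU0 hL2.le
  have hwL : w * L ^ 2 ≤ 7 / 2 := by rw [hw, div_mul_cancel₀ _ hL2.ne']; exact hU1
  have hUn : U * (n ^ 2 / L ^ 2) = w * n ^ 2 := by rw [hw]; field_simp
  rw [hUn] at hstoner
  have hmono := quad_mono (c := 8) (σ := 0.9) hw0 hwL (by linarith) (by linarith) (by norm_num) (by norm_num)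
    (n := n) (n₀ := 0.425 * L ^ 2 - 1)
  have hceil := quad_ceiling (ν := 0.425) hw0 hwL (by nlinarith) (by linarith : 0.425 * L ^ 2 - 1 ≤ 0.425 * L ^ 2)
  have hT' : T ≤ -4 * (A * B) + 4 * sur := by linarith
  nlinarith [hmono, hceil, hstoner, hT', hM, hsur, hLL]

omit [NeZero L] in
/-- Piece `δ ∈ [3/20, 1/5]` (band edge; pure arithmetic). [folklore] -/
theorem deficiency_exact_arith_A2 {L n S T A B sur U : ℝ} (hL : 6000 ≤ L) (hU0 : 0 ≤ U) (hU1 : U ≤ 7 / 2)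
    (hn_lo : 0.4 * L ^ 2 - 1 ≤ n) (hn_hi : n ≤ 0.425 * L ^ 2)
    (hstoner : 8 * S ≤ 4 * L ^ 2 + 2 * T + U * (n ^ 2 / L ^ 2))
    (hT : T ≤ -4 * A * B + 4 * sur) (hM : 0.885 * (0.6324 * L - 3) * (L * (1 / 3.141593)) ≤ A * B)
    (hsur : sur ≤ 4 * L + 3) : L ^ 2 / 200 ≤ n - S := by
  have hLpos : 0 < L := by linarith
  have hL2 : 0 < L ^ 2 := by positivity
  have hLL : 6000 * L ≤ L ^ 2 := by nlinarith
  set w := U / L ^ 2 with hw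
  have hw0 : 0 ≤ w := div_nonneg hU0 hL2.le
  have hwL : w * L ^ 2 ≤ 7 / 2 := by rw [hw, div_mul_cancel₀ _ hL2.ne']; exact hU1
  have hUn : U * (n ^ 2 / L ^ 2) = w * n ^ 2 := by rw [hw]; field_simp
  rw [hUn] at hstoner
  have hmono := quad_mono (c := 8) (σ := 0.85) hw0 hwL (by linarith) (by linarith) (by norm_num) (by norm_num)
    (n := n) (n₀ := 0.4 * L ^ 2 - 1)
  have hceil := quad_ceiling (ν := 0.4) hw0 hwL (by nlinarith) (by linarith : 0.4 * L ^ 2 - 1 ≤ 0.4 * L ^ 2)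
  have hT' : T ≤ -4 * (A * B) + 4 * sur := by linarith
  nlinarith [hmono, hceil, hstoner, hT', hM, hsur, hLL]

omit [NeZero L] in
/-- Piece `δ ∈ [1/5, 1/4]` (shifted bound at `μ = 7/5`, `t = 39/10`, moment term `1921/1000 · L²`; pure
arithmetic). [folklore] -/
theorem deficiency_exact_arith_B1 {L n S T A B sur U : ℝ} (hL : 6000 ≤ L) (hU0 : 0 ≤ U) (hU1 : U ≤ 7 / 2)
    (hn_lo : 0.375 * L ^ 2 - 1 ≤ n) (hn_hi : n ≤ 0.4 * L ^ 2)
    (hstoner : 2 * (7 / 5 : ℝ) * n - L ^ 2 * (4 + (39 / 10 : ℝ) ^ 2) / (4 * (39 / 10 - 7 / 5)) - 2 * T -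
      U * (n ^ 2 / L ^ 2) ≤ (7 / 5 + 4) * (n - S))
    (hT : T ≤ -4 * A * B + 4 * sur) (hM : 0.913 * (0.6123 * L - 3) * (L * (1 / 3.141593)) ≤ A * B)
    (hsur : sur ≤ 4 * L + 3) : L ^ 2 / 200 ≤ n - S := by
  have hLpos : 0 < L := by linarith
  have hL2 : 0 < L ^ 2 := by positivity
  have hLL : 6000 * L ≤ L ^ 2 := by nlinarith
  set w := U / L ^ 2 with hw
  have hw0 : 0 ≤ w := div_nonneg hU0 hL2.le
  have hwL : w * L ^ 2 ≤ 7 / 2 := by rw [hw, div_mul_cancel₀ _ hL2.ne']; exact hU1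
  have hUn : U * (n ^ 2 / L ^ 2) = w * n ^ 2 := by rw [hw]; field_simp
  rw [hUn] at hstoner
  norm_num at hstoner
  have hmono := quad_mono (c := 14 / 5) (σ := 0.775) hw0 hwL (by linarith) (by linarith) (by norm_num)
    (by norm_num) (n := n) (n₀ := 0.375 * L ^ 2 - 1)
  have hceil := quad_ceiling (ν := 0.375) hw0 hwL (by nlinarith) (by linarith : 0.375 * L ^ 2 - 1 ≤ 0.375 * L ^ 2)
  have hT' : T ≤ -4 * (A * B) + 4 * sur := by linarith
  nlinarith [hmono, hceil, hstoner, hT', hM, hsur, hLL]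

omit [NeZero L] in
/-- Piece `δ ∈ [1/4, 3/10]` (shifted bound at `μ = 13/10`, `t = 37/10`; pure arithmetic). [folklore] -/
theorem deficiency_exact_arith_B2 {L n S T A B sur U : ℝ} (hL : 6000 ≤ L) (hU0 : 0 ≤ U) (hU1 : U ≤ 7 / 2)
    (hn_lo : 0.35 * L ^ 2 - 1 ≤ n) (hn_hi : n ≤ 0.375 * L ^ 2)
    (hstoner : 2 * (13 / 10 : ℝ) * n - L ^ 2 * (4 + (37 / 10 : ℝ) ^ 2) / (4 * (37 / 10 - 13 / 10)) - 2 * T -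
      U * (n ^ 2 / L ^ 2) ≤ (13 / 10 + 4) * (n - S))
    (hT : T ≤ -4 * A * B + 4 * sur) (hM : 0.937 * (0.5916 * L - 3) * (L * (1 / 3.141593)) ≤ A * B)
    (hsur : sur ≤ 4 * L + 3) : L ^ 2 / 200 ≤ n - S := by
  have hLpos : 0 < L := by linarith
  have hL2 : 0 < L ^ 2 := by positivity
  have hLL : 6000 * L ≤ L ^ 2 := by nlinarith
  set w := U / L ^ 2 with hw
  have hw0 : 0 ≤ w := div_nonneg hU0 hL2.le
  have hwL : w * L ^ 2 ≤ 7 / 2 := by rw [hw, div_mul_cancel₀ _ hL2.ne']; exact hU1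
  have hUn : U * (n ^ 2 / L ^ 2) = w * n ^ 2 := by rw [hw]; field_simp
  rw [hUn] at hstoner
  norm_num at hstoner
  have hmono := quad_mono (c := 13 / 5) (σ := 0.725) hw0 hwL (by linarith) (by linarith) (by norm_num)
    (by norm_num) (n := n) (n₀ := 0.35 * L ^ 2 - 1)
  have hceil := quad_ceiling (ν := 0.35) hw0 hwL (by nlinarith) (by linarith : 0.35 * L ^ 2 - 1 ≤ 0.35 * L ^ 2)
  have hT' : T ≤ -4 * (A * B) + 4 * sur := by linarith
  nlinarith [hmono, hceil, hstoner, hT', hM, hsur, hLL]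

/-! ### The four pieces, assembled -/

omit [NeZero L] in
/-- The filling `n = ⌊(1-δ)L²/2⌋` in real terms on the four pieces, with the square conditions
`(aL - 1)² ≤ n < (bL)²` of each piece (pure arithmetic). [folklore] -/
theorem filling_bounds_four {δ L n : ℝ} (hL : 6000 ≤ L) (hδ1 : 1 / 10 ≤ δ) (hδ2 : δ ≤ 3 / 10)
    (hn_le : n ≤ (1 - δ) * L ^ 2 / 2) (hn_ge : (1 - δ) * L ^ 2 / 2 - 1 ≤ n) :
    1 ≤ n ∧ n ≤ L ^ 2 ∧
      (δ ≤ 3 / 20 → 0.425 * L ^ 2 - 1 ≤ n ∧ n ≤ 0.45 * L ^ 2 ∧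
        (0.6519 * L - 1) ^ 2 ≤ n ∧ n < (0.6709 * L) ^ 2) ∧
      (3 / 20 ≤ δ → δ ≤ 1 / 5 → 0.4 * L ^ 2 - 1 ≤ n ∧ n ≤ 0.425 * L ^ 2 ∧
        (0.6324 * L - 1) ^ 2 ≤ n ∧ n < (0.652 * L) ^ 2) ∧
      (1 / 5 ≤ δ → δ ≤ 1 / 4 → 0.375 * L ^ 2 - 1 ≤ n ∧ n ≤ 0.4 * L ^ 2 ∧
        (0.6123 * L - 1) ^ 2 ≤ n ∧ n < (0.6325 * L) ^ 2) ∧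
      (1 / 4 ≤ δ → 0.35 * L ^ 2 - 1 ≤ n ∧ n ≤ 0.375 * L ^ 2 ∧
        (0.5916 * L - 1) ^ 2 ≤ n ∧ n < (0.6124 * L) ^ 2) := by
  have hL2 : (6000 : ℝ) * 6000 ≤ L ^ 2 := by nlinarith
  have hLL : 6000 * L ≤ L ^ 2 := by nlinarith
  have hmul : ∀ {a b : ℝ}, a ≤ b → a * L ^ 2 ≤ b * L ^ 2 := fun h => mul_le_mul_of_nonneg_right h (sq_nonneg L)
  have hδL1 := hmul hδ1
  have hδL2 := hmul hδ2
  refine ⟨by nlinarith, by nlinarith, fun h => ?_, fun h h' => ?_, fun h h' => ?_, fun h => ?_⟩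
  · have := hmul h
    have hlo : 0.425 * L ^ 2 - 1 ≤ n := by nlinarith
    exact ⟨hlo, by nlinarith, by nlinarith, by nlinarith⟩
  · have := hmul h; have := hmul h'
    have hlo : 0.4 * L ^ 2 - 1 ≤ n := by nlinarith
    exact ⟨hlo, by nlinarith, by nlinarith, by nlinarith⟩
  · have := hmul h; have := hmul h'
    have hlo : 0.375 * L ^ 2 - 1 ≤ n := by nlinarith
    exact ⟨hlo, by nlinarith, by nlinarith, by nlinarith⟩
  · have := hmul h
    have hlo : 0.35 * L ^ 2 - 1 ≤ n := by nlinarith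
    exact ⟨hlo, by nlinarith, by nlinarith, by nlinarith⟩

/-- **EXTENSIVE SPIN DEFICIENCY FOR `U ≤ 7/2`.** For `0 ≤ U ≤ 7/2`, `δ ∈ [1/10, 3/10]`, every `L ≥ 6000` and
every ground state `ψ` of the `(2n, S^z = 0)` sector (`n = ⌊(1-δ)L²/2⌋`) of `hubbardTorus 2 L 1 U` with
`S² ψ = S(S+1) ψ`, `S ≤ n`: `L²/200 ≤ n - S` (four pieces, module docstring). Stoner (1938); Penn (1966);
Tasaki (1998) §5. [folklore] -/
theorem spinDeficiency_ge_of_coupling_le {U δ : ℝ} (hU : U ∈ Set.Icc (0:ℝ) (7 / 2))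
    (hδ : δ ∈ Set.Icc (1 / 10 : ℝ) (3 / 10)) {L : ℕ} [NeZero L] (hL : 6000 ≤ L)
    {ψ : Fock (Orb (FermionTorus 2 L))}
    (hgs : IsGroundStateInSector (hubbardTorus 2 L 1 U) (2 * ⌊(1 - δ) * (L : ℝ) ^ 2 / 2⌋₊) 0 ψ)
    {S : ℕ} (hS : S ≤ ⌊(1 - δ) * (L : ℝ) ^ 2 / 2⌋₊)
    (hspin : spinSq *ᵥ ψ = (((S : ℝ) * ((S : ℝ) + 1) : ℝ) : ℂ) • ψ) :
    (L : ℝ) ^ 2 / 200 ≤ ((⌊(1 - δ) * (L : ℝ) ^ 2 / 2⌋₊ - S : ℕ) : ℝ) := by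
  obtain ⟨hU0, hU1⟩ := hU
  obtain ⟨hδ1, hδ2⟩ := hδ
  set n : ℕ := ⌊(1 - δ) * (L : ℝ) ^ 2 / 2⌋₊ with hn_def
  have hL3 : 3 ≤ L := le_trans (by norm_num) hL
  have hLr : (6000 : ℝ) ≤ L := by exact_mod_cast hL
  have hLpos : (0 : ℝ) < L := by linarith
  -- the filling `n` in real terms
  have hx0 : 0 ≤ (1 - δ) * (L : ℝ) ^ 2 / 2 := by
    have : 0 ≤ 1 - δ := by linarith
    positivity
  have hn_le : (n : ℝ) ≤ (1 - δ) * (L : ℝ) ^ 2 / 2 := Nat.floor_le hx0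
  have hn_ge : (1 - δ) * (L : ℝ) ^ 2 / 2 - 1 ≤ (n : ℝ) := by
    have := Nat.lt_floor_add_one ((1 - δ) * (L : ℝ) ^ 2 / 2)
    linarith
  obtain ⟨hn1r, hnLr, hA1, hA2, hB1, hB2⟩ := filling_bounds_four hLr hδ1 hδ2 hn_le hn_ge
  have hn1 : 1 ≤ n := by exact_mod_cast hn1r
  have hnL : n ≤ L ^ 2 := by exact_mod_cast hnLr
  -- the largest centred odd square inside the Fermi area
  obtain ⟨h, hm1, hm2⟩ := exists_odd_sq_le_lt hn1
  set m : ℕ := 2 * h + 1 with hm_def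
  have hm2' : n < (m + 2) ^ 2 := by
    rw [show m + 2 = 2 * h + 3 by omega]
    exact hm2
  have hmr1 : ((m : ℝ)) ^ 2 ≤ (n : ℝ) := by exact_mod_cast hm1
  have hmr2 : (n : ℝ) < ((m : ℝ) + 2) ^ 2 := by exact_mod_cast hm2'
  have hm_pos : (0 : ℝ) ≤ (m : ℝ) := by positivity
  have hπ := Real.pi_pos
  have hπ3 := Real.pi_lt_d6
  have e1 : ((2 * h + 1 : ℕ) : ℝ) = (m : ℝ) := by rw [hm_def]
  have e_arg : ((2 * h + 1 : ℕ) : ℝ) * Real.pi / L = Real.pi * ((m : ℝ) / L) := by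
    rw [hm_def]; field_simp
  -- the surplus momenta: `n - m² ≤ 4m + 3 ≤ 4L + 3` once `m ≤ L`
  have hsur_of : m ≤ L → ((n - (2 * h + 1) ^ 2 : ℕ) : ℝ) ≤ 4 * (L : ℝ) + 3 := by
    intro hmL
    have h1 : n - (2 * h + 1) ^ 2 ≤ 4 * L + 3 := by
      have h2 : n < (2 * h + 1) ^ 2 + 4 * (2 * h + 1) + 4 := by
        have e : (2 * h + 3) ^ 2 = (2 * h + 1) ^ 2 + 4 * (2 * h + 1) + 4 := by ring
        rw [← e]
        exact hm2
      have h3 : 2 * h + 1 ≤ L := by simpa [hm_def] using hmL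
      omega
    exact_mod_cast h1
  -- `c (a L - 3) L / 3.141593 ≤ m (L/π) sin(mπ/L)` from `c ≤ sin`, `a L - 3 ≤ m`
  have hkey_of : ∀ c a : ℝ, 0 ≤ c → 0 ≤ a * (L : ℝ) - 3 → a * (L : ℝ) - 3 ≤ (m : ℝ) →
      c ≤ Real.sin ((2 * h + 1 : ℕ) * Real.pi / L) →
      c * (a * (L : ℝ) - 3) * ((L : ℝ) * (1 / 3.141593)) ≤
        ((2 * h + 1 : ℕ) : ℝ) * ((L : ℝ) / Real.pi * Real.sin ((2 * h + 1 : ℕ) * Real.pi / L)) := by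
    intro c a hc hA0 hA hsin
    rw [e1]
    have hB : (L : ℝ) * (1 / 3.141593) ≤ (L : ℝ) / Real.pi := by
      have hinv : (1 : ℝ) / 3.141593 ≤ 1 / Real.pi := one_div_le_one_div_of_le hπ hπ3.le
      calc (L : ℝ) * (1 / 3.141593) ≤ (L : ℝ) * (1 / Real.pi) := mul_le_mul_of_nonneg_left hinv hLpos.le
        _ = (L : ℝ) / Real.pi := by ring
    calc c * (a * (L : ℝ) - 3) * ((L : ℝ) * (1 / 3.141593))
        = (a * (L : ℝ) - 3) * (((L : ℝ) * (1 / 3.141593)) * c) := by ring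
      _ ≤ (m : ℝ) * (((L : ℝ) / Real.pi) * Real.sin ((2 * h + 1 : ℕ) * Real.pi / L)) := by
          apply mul_le_mul hA _ (by positivity) hm_pos
          exact mul_le_mul hB hsin hc (by positivity)
      _ = (m : ℝ) * ((L : ℝ) / Real.pi * Real.sin ((2 * h + 1 : ℕ) * Real.pi / L)) := by ring
  -- the sine at the side ratio `m/L ∈ [1/2, b]`, `b = 1/2 + τ`
  have hsin_of : ∀ a b τ : ℝ, b = 1 / 2 + τ → 0 ≤ τ → τ ≤ 1 / 2 → a * (L : ℝ) - 3 < (m : ℝ) →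
      (m : ℝ) < b * L → (L : ℝ) / 2 ≤ a * L - 3 →
      1 - (3.141593 * τ) ^ 2 / 2 ≤ Real.sin ((2 * h + 1 : ℕ) * Real.pi / L) := by
    intro a b τ hb hτ0 hτ1 hlo hhi hhalf
    rw [e_arg]
    apply sin_pi_mul_ge_of_le _ _ hτ0 hτ1
    · rw [le_div_iff₀ hLpos]; linarith
    · rw [div_le_iff₀ hLpos, ← hb]; linarith
  -- the trial sea, given `m ≤ L`
  have htrial_of : m ≤ L → ∃ T : Finset (TorusSite 2 L), T.card = n ∧
      ∑ k ∈ T, torusBand L k ≤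
        -4 * ((2 * h + 1 : ℕ) : ℝ) * ((L : ℝ) / Real.pi * Real.sin ((2 * h + 1 : ℕ) * Real.pi / L)) +
          4 * ((n - (2 * h + 1) ^ 2 : ℕ) : ℝ) := fun hmL =>
    exists_trialSet_card_eq hL3 h (by simpa [hm_def] using hmL) hm1 hnL
  rw [Nat.cast_sub hS]
  by_cases hpA : δ ≤ 1 / 5
  · by_cases hpA1 : δ ≤ 3 / 20
    · -- piece A1: `δ ∈ [1/10, 3/20]`, band edge
      obtain ⟨hn_lo, hn_hi, hsq1, hsq2⟩ := hA1 hpA1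
      obtain ⟨hm_lo, hm_hi⟩ := square_side_bounds_of hm_pos hmr1 hmr2 hsq1 hsq2 (by positivity)
      have hmL : m ≤ L := by exact_mod_cast (show (m : ℝ) ≤ L by linarith)
      obtain ⟨T, hTcard, hTsum⟩ := htrial_of hmL
      have hstoner := eight_spin_le_of_pairedSea_exact hL3 hU0 hS hgs hspin (Finset.nodup_toList T)
        (by rw [Finset.length_toList, hTcard])
      rw [Finset.toList_toFinset] at hstoner
      have hsin := hsin_of 0.6519 0.6709 0.1709 (by norm_num) (by norm_num) (by norm_num) hm_lo hm_hi
        (by linarith)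
      have hkey := hkey_of 0.855 0.6519 (by norm_num) (by linarith) hm_lo.le (le_trans (by norm_num) hsin)
      exact deficiency_exact_arith_A1 hLr hU0 hU1 hn_lo hn_hi hstoner hTsum hkey (hsur_of hmL)
    · -- piece A2: `δ ∈ [3/20, 1/5]`, band edge
      push Not at hpA1
      obtain ⟨hn_lo, hn_hi, hsq1, hsq2⟩ := hA2 hpA1.le hpA
      obtain ⟨hm_lo, hm_hi⟩ := square_side_bounds_of hm_pos hmr1 hmr2 hsq1 hsq2 (by positivity)
      have hmL : m ≤ L := by exact_mod_cast (show (m : ℝ) ≤ L by linarith)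
      obtain ⟨T, hTcard, hTsum⟩ := htrial_of hmL
      have hstoner := eight_spin_le_of_pairedSea_exact hL3 hU0 hS hgs hspin (Finset.nodup_toList T)
        (by rw [Finset.length_toList, hTcard])
      rw [Finset.toList_toFinset] at hstoner
      have hsin := hsin_of 0.6324 0.652 0.152 (by norm_num) (by norm_num) (by norm_num) hm_lo hm_hi
        (by linarith)
      have hkey := hkey_of 0.885 0.6324 (by norm_num) (by linarith) hm_lo.le (le_trans (by norm_num) hsin)
      exact deficiency_exact_arith_A2 hLr hU0 hU1 hn_lo hn_hi hstoner hTsum hkey (hsur_of hmL)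
  · push Not at hpA
    by_cases hpB1 : δ ≤ 1 / 4
    · -- piece B1: `δ ∈ [1/5, 1/4]`, shifted bound at `μ = 7/5`, `t = 39/10`
      obtain ⟨hn_lo, hn_hi, hsq1, hsq2⟩ := hB1 hpA.le hpB1
      obtain ⟨hm_lo, hm_hi⟩ := square_side_bounds_of hm_pos hmr1 hmr2 hsq1 hsq2 (by positivity)
      have hmL : m ≤ L := by exact_mod_cast (show (m : ℝ) ≤ L by linarith)
      obtain ⟨T, hTcard, hTsum⟩ := htrial_of hmL
      have hμt : (7 / 5 : ℝ) < 39 / 10 := by norm_num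
      have hstoner := shifted_spin_le_of_pairedSea_exact hL3 hU0 hS hgs hspin (Finset.nodup_toList T)
        (by rw [Finset.length_toList, hTcard]) hμt
      rw [Finset.toList_toFinset] at hstoner
      have hsin := hsin_of 0.6123 0.6325 0.1325 (by norm_num) (by norm_num) (by norm_num) hm_lo hm_hi
        (by linarith)
      have hkey := hkey_of 0.913 0.6123 (by norm_num) (by linarith) hm_lo.le (le_trans (by norm_num) hsin)
      exact deficiency_exact_arith_B1 hLr hU0 hU1 hn_lo hn_hi hstoner hTsum hkey (hsur_of hmL)
    · -- piece B2: `δ ∈ [1/4, 3/10]`, shifted bound at `μ = 13/10`, `t = 37/10`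
      push Not at hpB1
      obtain ⟨hn_lo, hn_hi, hsq1, hsq2⟩ := hB2 hpB1.le
      obtain ⟨hm_lo, hm_hi⟩ := square_side_bounds_of hm_pos hmr1 hmr2 hsq1 hsq2 (by positivity)
      have hmL : m ≤ L := by exact_mod_cast (show (m : ℝ) ≤ L by linarith)
      obtain ⟨T, hTcard, hTsum⟩ := htrial_of hmL
      have hμt : (13 / 10 : ℝ) < 37 / 10 := by norm_num
      have hstoner := shifted_spin_le_of_pairedSea_exact hL3 hU0 hS hgs hspin (Finset.nodup_toList T)
        (by rw [Finset.length_toList, hTcard]) hμt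
      rw [Finset.toList_toFinset] at hstoner
      have hsin := hsin_of 0.5916 0.6124 0.1124 (by norm_num) (by norm_num) (by norm_num) hm_lo hm_hi
        (by linarith)
      have hkey := hkey_of 0.937 0.5916 (by norm_num) (by linarith) hm_lo.le (le_trans (by norm_num) hsin)
      exact deficiency_exact_arith_B2 hLr hU0 hU1 hn_lo hn_hi hstoner hTsum hkey (hsur_of hmL)

/-- **The near-saturation refuter hypothesis fails for `U ≤ 7/2`.** For `(U, δ) ∈ [0, 7/2] × [1/10, 3/10]` it
is NOT the case that for every `κ > 0` nearly saturated sector ground states (`n - S ≤ κL²`) occur along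
infinitely many even sides (`κ = 1/400`, `L ≥ 6000`, `spinDeficiency_ge_of_coupling_le`). So
`pointwise_false_of_nearlySaturated` and `fluctuationFloorAt_false_of_nearlySaturated` cannot fire on that
part of the (Q)/(D) box. [folklore] -/
theorem not_nearlySaturated_frequently_of_coupling_le {U δ : ℝ} (hU : U ∈ Set.Icc (0:ℝ) (7 / 2))
    (hδ : δ ∈ Set.Icc (1 / 10 : ℝ) (3 / 10)) :
    ¬ ∀ κ : ℝ, 0 < κ → ∃ᶠ L : ℕ in atTop, Even L ∧
      ∃ (ψ : Fock (Orb (FermionTorus 2 L))) (S : ℕ), S ≤ ⌊(1 - δ) * (L : ℝ) ^ 2 / 2⌋₊ ∧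
        IsGroundStateInSector (hubbardTorus 2 L 1 U) (2 * ⌊(1 - δ) * (L : ℝ) ^ 2 / 2⌋₊) 0 ψ ∧
          spinSq *ᵥ ψ = (((S : ℝ) * ((S : ℝ) + 1) : ℝ) : ℂ) • ψ ∧
            ((⌊(1 - δ) * (L : ℝ) ^ 2 / 2⌋₊ - S : ℕ) : ℝ) ≤ κ * (L : ℝ) ^ 2 := by
  intro hns
  obtain ⟨L, ⟨-, ψ, S, hS, hgs, hspin, hdef⟩, hLge⟩ :=
    ((hns (1 / 400) (by norm_num)).and_eventually (eventually_ge_atTop 6000)).exists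
  haveI : NeZero L := ⟨by omega⟩
  have h := spinDeficiency_ge_of_coupling_le hU hδ hLge hgs hS hspin
  have hLpos : (0 : ℝ) < L := by exact_mod_cast (show 0 < L by omega)
  nlinarith [sq_nonneg (L : ℝ), mul_pos hLpos hLpos]

end Box

end Summit.HubbardSuperconductivity.HubbardSuperconductivity.Theorems.MesoscopicPairOrder.Negative
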